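import Mathlib

/-!
# STUB-PLAN v3.7 critic certificate for card k2-g15 (crux stmt-BirchSwinnertonDyer-27851,
stub `stub_heegnerIndexLowerAtTwo`) — the 𝔭-local GAUSS COLUMN (R121′ ↦ R121″)

Mathlib-only bookkeeping; nothing here proves BSD, the crux, the stub or S2′.

* §1  (F1) Every character of `ℤ₂ˣ` of conductor exponent ≤ 3 is QUADRATIC: `(ℤ/8)ˣ` and `(ℤ/4)ˣ`
      have exponent 2, so a monoid hom out of them squares to 1; an order-4 character needs
      conductor `2⁴` (witness in `(ℤ/16)ˣ`).  Hence card k2-g15's K1 failure mode («the unit part of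
      `(χ′_d)_𝔓` is not quadratic») cannot occur on T3.1's branch (`n_v ∈ {2, 3}`).
* §2  (F2) de Shalit II.4.14 interpolates types `(k, j)` with `0 ≤ -j < k` (p. 71); the weight-2
      BDP-range pair has types `(1+m, -m)` and `(m, 1-m)`; the second is in range iff `1 ≤ m`, so at
      the finite-order point (`m = 0`) the factor of type `(0, 1)` carries NO interpolation constant
      (37): the pair cancellation must be run at in-range points, where the doubled 𝔓-digits of the two
      like-Gauss-sums (`2n(k) - 2n + n` each, from (37) with a Gauss sum of valuation `n/2`) add up to
      `2·(2nm)` — j-DEPENDENT, vanishing only at the excluded `m = 0`.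
* §3  (F3) de Shalit II.6.1 (1)/(2) (p. 81): `ε̌(𝔞) = ε⁻¹(𝔞̄)·N𝔞⁻¹` has infinity type
      `(-j-1, -k-1)`; the involution fixes the line `k + j = -1` and sends `(1, 0)` to `(-1, -2)`
      (out of range), NOT to the conjugate-direction type `(0, 1)`: II.6.4 (9) is not ρ3.
-/

namespace Summit.BirchSwinnertonDyer.BirchSwinnertonDyer.Cruxes.SplitBadTwoLowerHalfOfFacts.StubPlanK2G15

/-! ## §1  characters of 2-power conductor ≤ 8 are quadratic -/

theorem units_zmod8_sq (x : (ZMod 8)ˣ) : x * x = 1 := by revert x; decide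

theorem units_zmod4_sq (x : (ZMod 4)ˣ) : x * x = 1 := by revert x; decide

/-- Any character of `(ℤ/8)ˣ` with values in a commutative monoid squares to the trivial one. -/
theorem char_zmod8_quadratic {M : Type*} [CommMonoid M] (χ : (ZMod 8)ˣ →* M) (x : (ZMod 8)ˣ) :
    χ x * χ x = 1 := by
  rw [← map_mul, units_zmod8_sq, map_one]

theorem char_zmod4_quadratic {M : Type*} [CommMonoid M] (χ : (ZMod 4)ˣ →* M) (x : (ZMod 4)ˣ) :
    χ x * χ x = 1 := by
  rw [← map_mul, units_zmod4_sq, map_one]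

/-- … whereas `(ℤ/16)ˣ` has an element of order 4 (`3`), so order-4 characters of `ℤ₂ˣ` have
conductor exponent ≥ 4. -/
theorem units_zmod16_not_exponent_two : ∃ x : (ZMod 16)ˣ, x * x ≠ 1 := by decide

/-! ## §2  the in-range pair and its Gauss column -/

/-- de Shalit II.4.14's range `0 ≤ -j < k` for the type `(m, 1 - m)` factor: in range iff `1 ≤ m`. -/
theorem type_m_oneSubm_inRange_iff (m : ℤ) : (0 ≤ -(1 - m) ∧ -(1 - m) < m) ↔ 1 ≤ m := by omega

/-- … and the type `(1 + m, -m)` factor is in range for every `m ≥ 0`. -/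
theorem type_oneAddm_negm_inRange (m : ℤ) (hm : 0 ≤ m) : 0 ≤ -(-m) ∧ -(-m) < 1 + m := by omega

/-- At the finite-order point (`m = 0`) the second factor (type `(0,1)`) is OUT of range. -/
theorem type01_outOfRange : ¬ (0 ≤ -(1 - (0:ℤ)) ∧ -(1 - (0:ℤ)) < 0) := by omega

/-- Doubled 𝔓-digit of de Shalit's `G(ε) = φᵏφ̄ʲ(𝔭ⁿ)/pⁿ·g` (37) when `v(g) = n/2` at both places:
`2·v_𝔓 G = 2nk - 2n + n`.  For the in-range pair of types `(1+m,-m)` and `(m,1-m)` the digits add to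
`2·(2nm)`: the pair's Gauss column is `2nm` in single valuations — j-dependent, zero only at `m = 0`. -/
theorem inRangePair_gaussColumn (n m : ℤ) :
    (2 * n * (1 + m) - 2 * n + n) + (2 * n * m - 2 * n + n) = 2 * (2 * n * m) := by ring

theorem inRangePair_gaussColumn_eq_zero_iff (n m : ℤ) (hn : n ≠ 0) :
    2 * (2 * n * m) = 0 ↔ m = 0 := by
  constructor
  · intro h
    have : n * m = 0 := by linarith
    rcases mul_eq_zero.mp this with h1 | h1
    · exact absurd h1 hn
    · exact h1
  · rintro rfl; ring

/-- The `G·Ḡ` norm exponent `n(k+j-1)` vanishes on BOTH factors of the pair (types with `k+j = 1`). -/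
theorem normExponent_pair (n m : ℤ) : n * ((1 + m) + (-m) - 1) = 0 ∧ n * (m + (1 - m) - 1) = 0 := by
  constructor <;> ring

/-! ## §3  de Shalit's involution `ε ↦ ε̌` on infinity types -/

/-- Infinity type of `ε̌` (II.6.1): `(k, j) ↦ (-j-1, -k-1)`. -/
def checkType (t : ℤ × ℤ) : ℤ × ℤ := (-t.2 - 1, -t.1 - 1)

theorem checkType_involutive (t : ℤ × ℤ) : checkType (checkType t) = t := by
  unfold checkType; ext <;> simp

/-- The fixed types are exactly the line `k + j = -1` (de Shalit's anticyclotomic line, II.6.5). -/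
theorem checkType_fixed_iff (t : ℤ × ℤ) : checkType t = t ↔ t.1 + t.2 = -1 := by
  unfold checkType
  constructor
  · intro h
    have h1 := congrArg Prod.fst h
    simp at h1
    omega
  · intro h
    ext <;> simp <;> omega

/-- `(1,0) ↦ (-1,-2)`: the functional equation II.6.4 (9) relates the in-range type-(1,0) value to a
type-(-1,-2) value, not to the conjugate-direction type (0,1). -/
theorem checkType_one_zero : checkType (1, 0) = (-1, -2) := by decide

theorem checkType_one_zero_ne_zero_one : checkType (1, 0) ≠ (0, 1) := by decide

/-- `(-1,-2)` is outside II.4.14's range `0 ≤ -j < k` (k = -1). -/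
theorem checkType_one_zero_outOfRange : ¬ (0 ≤ -(-2:ℤ) ∧ -(-2:ℤ) < -1) := by omega

end Summit.BirchSwinnertonDyer.BirchSwinnertonDyer.Cruxes.SplitBadTwoLowerHalfOfFacts.StubPlanK2G15
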